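import Summits.MatrixMultiplication.MatrixMultiplication.Theorems.ObstructionDescentUniversalOccurrenceTwoRectangleStorey
import Summits.MatrixMultiplication.MatrixMultiplication.Theorems.ObstructionDescentUniversalOccurrenceTwoRectangleOddHookTableaux
import Summits.MatrixMultiplication.MatrixMultiplication.Theorems.ObstructionDescentUniversalOccurrenceTwoRectangleCrossLiftArith

set_option linter.dupNamespace false
set_option autoImplicit false

/-!
# Universal occurrence — two rectangles and the ODD HOOK, part C: `((2^N),(2^N),(2N-3,1,1,1)) ∈ S(⟨m⟩)`, `m ≥ N+2`
(decomp-mm · lens 3 · gen 44)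

Route `route-MatrixMultiplication-ObstructionDescent` (sub-problem `MatrixMultiplication`, `ω(ℂ) = 2`); SUPPORT for the crux
`NoOccurrenceObstruction` (`P_O`, item `stmt-MatrixMultiplication-29040`), universal-occurrence programme (NODE-g29…g44 of the
decomp-mm cell, lens 3).  Nothing here proves `ω = 2` or closes an item; no `def`, no `sorry`, standard axioms.
`occurs_unitTensor_twoRectangle_oddHook`: for all `N ≥ 4`, `m ≥ N + 2` the type `((2^N),(2^N),(2N-3,1,1,1))` occurs for `⟨m⟩` —
the first uniform family of the FOUR-ODD class (every earlier family has an EVEN third leg and comes from the floor slice; four odd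
parts are invisible to floor designs and, by weights, to `⟨N+1⟩`, memo NODE-g44 §3).  Certificate: the STOREY LAW (part X) on the
CROSS-LIFT DESIGN `X(N)` over `[N+2]` — legs `φ = (0,…,N-1 | 0,1)`, `ψ = (0,…,N-1 | 1,0)`, `γ = (0,2,0,…,0 | 1,3)` read into `e_T`
of the odd-hook tableau (part A), blocks `e = (q mod 2, q div 2)`, `e' = e ∘ (p₀ p₁)`.  A non-zero term has block bijections
`x = φ∘ι`, `χ = ψ∘ι∘(p₀ p₁)` agreeing off the hook column, so `χ = x∘ρ` with `ρ ∈ {1,(p₀p₂),(p₁p₃),(p₀p₂)(p₁p₃)}` (part B) and the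
LOCAL SIGN RULE (part B) makes `e_T(γ∘ι)` compensate `ζ_e(χ)/ζ_e(x)`: every non-zero term is `+1`; witness `ι_w = (N,N+1,1,0 | j ↦ j)`.
[cite: BurgisserIkenmeyer2011, §3.4 (Prop. 3.4), Thm. 4.4, Lemma 6.1] [cite: BurgisserIkenmeyer2017, §5, Thm. 5.9 (proof of (2)),
eq. (3.4)] [cite: Landsberg2017, §9.1.1]
-/

noncomputable section

open scoped BigOperators

namespace Summit.MatrixMultiplication.MatrixMultiplication.Theorems.ObstructionCalculus

open Literature.Computability.AlgebraicComplexity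
open Literature.NumberTheory.DiophantineGeometry

set_option maxHeartbeats 800000 in
/-- **`((2^N),(2^N),(2N-3,1,1,1))` occurs for `⟨m⟩` for all `N ≥ 4`, `m ≥ N + 2`** — the first uniform family whose third leg has
four ODD parts (outside the reach of the floor law).  Certificate: the storey law on the cross-lift design `X(N)`.
[cite: BurgisserIkenmeyer2011, Thm. 4.4, Lemma 6.1] [cite: BurgisserIkenmeyer2017, Thm. 5.9 (proof of (2)), eq. (3.4)] -/
theorem occurs_unitTensor_twoRectangle_oddHook {N m : ℕ} (hN : 4 ≤ N) (hNm : N + 2 ≤ m)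
    {lam : Fin 3 → Nat.Partition (N * 2)} (h0 : lam 0 = Nat.Partition.rectangle N 2)
    (h1 : lam 1 = Nat.Partition.rectangle N 2) (h2 : (lam 2).sortedParts = [2 * N - 3, 1, 1, 1]) :
    isotypicSum₁ (lam 0) (isotypicSum₂ (lam 1) (isotypicSum₃ (lam 2)
      (kroneckerPow (unitTensor ℂ m) (N * 2)))) ≠ 0 := by
  classical
  -- the shape and the odd-hook tableau `T`
  have hNY : ∀ x ∈ (lam 2).youngDiagram.cells, x.1 < N := fun x hx => by
    have := fst_lt_of_mem_youngDiagram_oddHook (lam 2) h2 hx; omega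
  have hd : (lam 2).youngDiagram.cells.card = N * 2 := Nat.Partition.card_cells_youngDiagram _; have h4 : 4 ≤ N * 2 := by omega
  obtain ⟨T, hT⟩ : ∃ T : StdFilling (N * 2) (lam 2).youngDiagram, ∀ p : Fin (N * 2), T.1 p =
      (if (p : ℕ) < 4 then ((p : ℕ), 0) else (0, (p : ℕ) - 3)) :=
    ⟨⟨fun p => if (p : ℕ) < 4 then ((p : ℕ), 0) else (0, (p : ℕ) - 3),
      ⟨fun p => oddHookCell_mem (by omega) (lam 2) h2 p p.2,
       fun p q hpq => Fin.ext (oddHookCell_injective hpq),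
       fun p q hpq => oddHookCell_standard hpq⟩⟩, fun p => rfl⟩
  have hM : StdFilling.polytabloid ℂ hNY T ∈
      highestWeightSpace (wordRep ℂ N (N * 2)) (Weight.ofPartition N (lam 2)) := by
    rw [← ydWeight_youngDiagram]; exact StdFilling.polytabloid_mem hNY T hd
  -- the hook column `p₀ p₁ p₂ p₃`, the slots `s₀ s₁`, the block structures `e`, `e' = e ∘ (p₀ p₁)`
  obtain ⟨p0, hp0⟩ : ∃ p : Fin (N * 2), (p : ℕ) = 0 := ⟨⟨0, by omega⟩, rfl⟩; obtain ⟨p1, hp1⟩ : ∃ p : Fin (N * 2), (p : ℕ) = 1 :=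
    ⟨⟨1, by omega⟩, rfl⟩; obtain ⟨p2, hp2⟩ : ∃ p : Fin (N * 2), (p : ℕ) = 2 := ⟨⟨2, by omega⟩, rfl⟩
  obtain ⟨p3, hp3⟩ : ∃ p : Fin (N * 2), (p : ℕ) = 3 := ⟨⟨3, by omega⟩, rfl⟩
  have hpne : ∀ {q q' : Fin (N * 2)}, (q : ℕ) ≠ (q' : ℕ) → q ≠ q' := fun h hqq' => h (congrArg Fin.val hqq')
  have hp01 : p0 ≠ p1 := hpne (by omega); have hp02 : p0 ≠ p2 := hpne (by omega)
  have hp03 : p0 ≠ p3 := hpne (by omega); have hp12 : p1 ≠ p2 := hpne (by omega)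
  have hp13 : p1 ≠ p3 := hpne (by omega); have hp23 : p2 ≠ p3 := hpne (by omega)
  have hP0 : (⟨0, by omega⟩ : Fin (N * 2)) = p0 := Fin.ext (by rw [hp0])
  have hP1 : (⟨1, by omega⟩ : Fin (N * 2)) = p1 := Fin.ext (by rw [hp1])
  have hP2 : (⟨2, by omega⟩ : Fin (N * 2)) = p2 := Fin.ext (by rw [hp2])
  have hP3 : (⟨3, by omega⟩ : Fin (N * 2)) = p3 := Fin.ext (by rw [hp3])
  have hcases : ∀ q : Fin (N * 2), (q : ℕ) < 4 → q = p0 ∨ q = p1 ∨ q = p2 ∨ q = p3 := by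
    intro q hq
    have h : (q : ℕ) = 0 ∨ (q : ℕ) = 1 ∨ (q : ℕ) = 2 ∨ (q : ℕ) = 3 := by omega
    rcases h with h | h | h | h
    · exact Or.inl (Fin.ext (by rw [h, hp0]))
    · exact Or.inr (Or.inl (Fin.ext (by rw [h, hp1])))
    · exact Or.inr (Or.inr (Or.inl (Fin.ext (by rw [h, hp2]))))
    · exact Or.inr (Or.inr (Or.inr (Fin.ext (by rw [h, hp3]))))
  obtain ⟨s0, hs0⟩ : ∃ s : Fin N, (s : ℕ) = 0 := ⟨⟨0, by omega⟩, rfl⟩; obtain ⟨s1, hs1⟩ : ∃ s : Fin N, (s : ℕ) = 1 := ⟨⟨1, by omega⟩, rfl⟩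
  have hs01 : s0 ≠ s1 := by rw [Ne, Fin.ext_iff, hs0, hs1]; omega
  obtain ⟨e, he⟩ : ∃ e : Fin (N * 2) ≃ Fin 2 × Fin N,
      e = finProdFinEquiv.symm.trans (Equiv.prodComm (Fin N) (Fin 2)) := ⟨_, rfl⟩
  have hev : ∀ q : Fin (N * 2), (((e q).1 : Fin 2) : ℕ) = (q : ℕ) % 2 ∧ (((e q).2 : Fin N) : ℕ) = (q : ℕ) / 2 := by
    intro q; rw [he]; simp [Fin.modNat, Fin.divNat]
  have hesymm : ∀ (a : Fin 2) (j : Fin N), ((e.symm (a, j) : Fin (N * 2)) : ℕ) = (a : ℕ) + 2 * (j : ℕ) := by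
    intro a j
    obtain ⟨ha, hj⟩ := hev (e.symm (a, j))
    rw [Equiv.apply_symm_apply] at ha hj
    dsimp only at ha hj
    omega
  have hq00 : e.symm (0, s0) = p0 := Fin.ext (by rw [hesymm, hp0, hs0]; simp)
  have hq10 : e.symm (1, s0) = p1 := Fin.ext (by rw [hesymm, hp1, hs0]; simp)
  have hq01 : e.symm (0, s1) = p2 := Fin.ext (by rw [hesymm, hp2, hs1]; simp)
  have hq11 : e.symm (1, s1) = p3 := Fin.ext (by rw [hesymm, hp3, hs1]; simp)
  have hblk02 : (e p0).1 = (e p2).1 := Fin.ext (by rw [(hev p0).1, (hev p2).1]; omega)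
  have hblk13 : (e p1).1 = (e p3).1 := Fin.ext (by rw [(hev p1).1, (hev p3).1]; omega)
  obtain ⟨κ, hκ⟩ : ∃ κ : Equiv.Perm (Fin (N * 2)), κ = Equiv.swap p0 p1 := ⟨_, rfl⟩
  have hκ0 : κ p0 = p1 := (by rw [hκ, Equiv.swap_apply_left]); have hκ1 : κ p1 = p0 := by rw [hκ, Equiv.swap_apply_right]
  have hκq : ∀ q : Fin (N * 2), (q : ℕ) ≠ 0 → (q : ℕ) ≠ 1 → κ q = q := fun q hq0 hq1 => by
    rw [hκ]; exact Equiv.swap_apply_of_ne_of_ne (hpne (by omega)) (hpne (by omega))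
  obtain ⟨e', he'⟩ : ∃ e' : Fin (N * 2) ≃ Fin 2 × Fin N, e' = κ.symm.trans e := ⟨_, rfl⟩
  have hζ' : ∀ y : Word N (N * 2), wordBlockSign ℂ e' y = wordBlockSign ℂ e (y ∘ ⇑κ) := by
    intro y; rw [he', wordBlockSign_comp_perm]
  -- the design `X(N)` on the alphabet `[N+2]`
  obtain ⟨φ, hφv⟩ : ∃ φ : Fin (N + 2) → Fin N, ∀ r, ((φ r : Fin N) : ℕ) =
      if (r : ℕ) < N then (r : ℕ) else (r : ℕ) - N :=
    ⟨fun r => ⟨if (r : ℕ) < N then (r : ℕ) else (r : ℕ) - N, by have := r.2; split_ifs <;> omega⟩, fun r => rfl⟩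
  obtain ⟨ψ, hψv⟩ : ∃ ψ : Fin (N + 2) → Fin N, ∀ r, ((ψ r : Fin N) : ℕ) =
      if (r : ℕ) < N then (r : ℕ) else N + 1 - (r : ℕ) :=
    ⟨fun r => ⟨if (r : ℕ) < N then (r : ℕ) else N + 1 - (r : ℕ), by have := r.2; split_ifs <;> omega⟩, fun r => rfl⟩
  obtain ⟨γ, hγv⟩ : ∃ γ : Fin (N + 2) → Fin N, ∀ r, ((γ r : Fin N) : ℕ) =
      if (r : ℕ) = 1 then 2 else if (r : ℕ) = N then 1 else if (r : ℕ) = N + 1 then 3 else 0 :=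
    ⟨fun r => ⟨if (r : ℕ) = 1 then 2 else if (r : ℕ) = N then 1 else if (r : ℕ) = N + 1 then 3 else 0,
      by split_ifs <;> omega⟩, fun r => rfl⟩
  refine occurs_unitTensor_twoRectangle_of_liftDesign_ne_zero (le_trans (Nat.le_add_right N 2) hNm) hNm φ ψ γ e e'
    h0 h1 hM ?_
  -- THE HEART: every non-zero term equals `1`
  have hVAL : ∀ ι : Fin (N * 2) → Fin (N + 2),
      wordBlockSign ℂ e (φ ∘ ι) * (wordBlockSign ℂ e' (ψ ∘ ι) * StdFilling.polytabloid ℂ hNY T (γ ∘ ι)) ≠ 0 →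
      wordBlockSign ℂ e (φ ∘ ι) * (wordBlockSign ℂ e' (ψ ∘ ι) * StdFilling.polytabloid ℂ hNY T (γ ∘ ι)) = 1 := by
    intro ι hne
    rw [hζ'] at hne ⊢
    set x : Word N (N * 2) := φ ∘ ι with hxdef
    set χ : Word N (N * 2) := (ψ ∘ ι) ∘ ⇑κ with hχdef
    set w : Word N (N * 2) := γ ∘ ι with hwdef
    have hx0 : wordBlockSign ℂ e x ≠ 0 := fun h => hne (by rw [h, zero_mul])
    have hχ0 : wordBlockSign ℂ e χ ≠ 0 := fun h => hne (by rw [h, zero_mul, mul_zero])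
    have hw0 : StdFilling.polytabloid ℂ hNY T w ≠ 0 := fun h => hne (by rw [h, mul_zero, mul_zero])
    obtain ⟨harm, hlt, hinj⟩ := oddHookTableau_support hNY T hT hw0
    have hxv : ∀ q, ((x q : Fin N) : ℕ) =
        if ((ι q : Fin (N + 2)) : ℕ) < N then ((ι q : Fin (N + 2)) : ℕ) else ((ι q : Fin (N + 2)) : ℕ) - N :=
      fun q => hφv (ι q)
    have hχv : ∀ q, ((χ q : Fin N) : ℕ) =
        if ((ι (κ q) : Fin (N + 2)) : ℕ) < N then ((ι (κ q) : Fin (N + 2)) : ℕ) else N + 1 - ((ι (κ q) : Fin (N + 2)) : ℕ) :=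
      fun q => hψv (ι (κ q))
    have hwv : ∀ q, ((w q : Fin N) : ℕ) =
        if ((ι q : Fin (N + 2)) : ℕ) = 1 then 2 else if ((ι q : Fin (N + 2)) : ℕ) = N then 1
          else if ((ι q : Fin (N + 2)) : ℕ) = N + 1 then 3 else 0 :=
      fun q => hγv (ι q)
    -- off the column the arm letters are generic, so `x` and `χ` agree there
    have hagree : ∀ q : Fin (N * 2), 4 ≤ (q : ℕ) → χ q = x q := by
      intro q hq
      have h1 := harm q hq
      rw [hwv] at h1
      have hlt' : ((ι q : Fin (N + 2)) : ℕ) < N := by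
        have := (ι q).2
        split_ifs at h1
        all_goals omega
      apply Fin.ext
      rw [hxv, hχv, hκq q (by omega) (by omega), if_pos hlt', if_pos hlt']
    -- block bijectivity and the dichotomies
    have hbx := bijective_of_wordBlockSign_ne_zero e hx0
    have hbχ := bijective_of_wordBlockSign_ne_zero e hχ0
    have hoff : ∀ (a : Fin 2) (s : Fin N), s ≠ s0 → s ≠ s1 →
        (fun j => x (e.symm (a, j))) s = (fun j => χ (e.symm (a, j))) s := by
      intro a s h0' h1'
      have h0'' : (s : ℕ) ≠ 0 := fun h => h0' (Fin.ext (by rw [h, hs0]))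
      have h1'' : (s : ℕ) ≠ 1 := fun h => h1' (Fin.ext (by rw [h, hs1]))
      exact (hagree (e.symm (a, s)) (by rw [hesymm]; omega)).symm
    have hd0 := bijective_agree_off_two (hbx 0) (hbχ 0) hs01 (hoff 0)
    have hd1 := bijective_agree_off_two (hbx 1) (hbχ 1) hs01 (hoff 1)
    simp only [hq00, hq01] at hd0
    simp only [hq10, hq11] at hd1
    have hxi0 : x p0 ≠ x p2 := fun h => hs01 ((hbx 0).1 (by simp only [hq00, hq01]; exact h))
    have hxi1 : x p1 ≠ x p3 := fun h => hs01 ((hbx 1).1 (by simp only [hq10, hq11]; exact h))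
    have hχi0 : χ p0 ≠ χ p2 := fun h => hs01 ((hbχ 0).1 (by simp only [hq00, hq01]; exact h))
    have hχi1 : χ p1 ≠ χ p3 := fun h => hs01 ((hbχ 1).1 (by simp only [hq10, hq11]; exact h))
    -- the model letters of the four column letters
    obtain ⟨k0, hk0⟩ : ∃ k : ℕ, k = (if ((ι p0 : Fin (N + 2)) : ℕ) < 2 then ((ι p0 : Fin (N + 2)) : ℕ)
        else if ((ι p0 : Fin (N + 2)) : ℕ) < N then 2 else ((ι p0 : Fin (N + 2)) : ℕ) + 4 - N) := ⟨_, rfl⟩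
    obtain ⟨k1, hk1⟩ : ∃ k : ℕ, k = (if ((ι p1 : Fin (N + 2)) : ℕ) < 2 then ((ι p1 : Fin (N + 2)) : ℕ)
        else if ((ι p1 : Fin (N + 2)) : ℕ) < N then 2 else ((ι p1 : Fin (N + 2)) : ℕ) + 4 - N) := ⟨_, rfl⟩
    obtain ⟨k2, hk2⟩ : ∃ k : ℕ, k = (if ((ι p2 : Fin (N + 2)) : ℕ) < 2 then ((ι p2 : Fin (N + 2)) : ℕ)
        else if ((ι p2 : Fin (N + 2)) : ℕ) < N then 2 else ((ι p2 : Fin (N + 2)) : ℕ) + 4 - N) := ⟨_, rfl⟩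
    obtain ⟨k3, hk3⟩ : ∃ k : ℕ, k = (if ((ι p3 : Fin (N + 2)) : ℕ) < 2 then ((ι p3 : Fin (N + 2)) : ℕ)
        else if ((ι p3 : Fin (N + 2)) : ℕ) < N then 2 else ((ι p3 : Fin (N + 2)) : ℕ) + 4 - N) := ⟨_, rfl⟩
    have hk0lt := modelLetter_lt (ι p0).2 hk0; have hk1lt := modelLetter_lt (ι p1).2 hk1
    have hk2lt := modelLetter_lt (ι p2).2 hk2; have hk3lt := modelLetter_lt (ι p3).2 hk3
    -- the column letters are distinct (support of `e_T`)
    have hWne : ∀ q q' : Fin (N * 2), (q : ℕ) < 4 → (q' : ℕ) < 4 → (q : ℕ) ≠ (q' : ℕ) →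
        (if ((ι q : Fin (N + 2)) : ℕ) = 1 then 2 else if ((ι q : Fin (N + 2)) : ℕ) = N then 1
          else if ((ι q : Fin (N + 2)) : ℕ) = N + 1 then 3 else 0) ≠
        (if ((ι q' : Fin (N + 2)) : ℕ) = 1 then 2 else if ((ι q' : Fin (N + 2)) : ℕ) = N then 1
          else if ((ι q' : Fin (N + 2)) : ℕ) = N + 1 then 3 else 0) := by
      intro q q' hq hq' hqq' h
      exact hqq' (congrArg Fin.val (hinj q q' hq hq' (Fin.ext (by rw [hwv, hwv]; exact h))))
    have hgen : ∀ q q' : Fin (N * 2), (q : ℕ) < 4 → (q' : ℕ) < 4 → (q : ℕ) ≠ (q' : ℕ) →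
        ¬ (2 ≤ ((ι q : Fin (N + 2)) : ℕ) ∧ ((ι q : Fin (N + 2)) : ℕ) < N ∧
           2 ≤ ((ι q' : Fin (N + 2)) : ℕ) ∧ ((ι q' : Fin (N + 2)) : ℕ) < N) := by
      intro q q' hq hq' hqq' hh
      exact hWne q q' hq hq' hqq' (by rw [modelLetter_col_generic hh.1 hh.2.1, modelLetter_col_generic hh.2.2.1 hh.2.2.2])
    have hW01 := hWne p0 p1 (by omega) (by omega) (by omega); have hW02 := hWne p0 p2 (by omega) (by omega) (by omega)
    have hW03 := hWne p0 p3 (by omega) (by omega) (by omega); have hW12 := hWne p1 p2 (by omega) (by omega) (by omega)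
    have hW13 := hWne p1 p3 (by omega) (by omega) (by omega); have hW23 := hWne p2 p3 (by omega) (by omega) (by omega)
    rw [modelLetter_col hN (ι p0).2 hk0, modelLetter_col hN (ι p1).2 hk1] at hW01
    rw [modelLetter_col hN (ι p0).2 hk0, modelLetter_col hN (ι p2).2 hk2] at hW02
    rw [modelLetter_col hN (ι p0).2 hk0, modelLetter_col hN (ι p3).2 hk3] at hW03
    rw [modelLetter_col hN (ι p1).2 hk1, modelLetter_col hN (ι p2).2 hk2] at hW12
    rw [modelLetter_col hN (ι p1).2 hk1, modelLetter_col hN (ι p3).2 hk3] at hW13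
    rw [modelLetter_col hN (ι p2).2 hk2, modelLetter_col hN (ι p3).2 hk3] at hW23
    -- block injectivity, transferred
    have x02m := modelLetter_ne_fst hN (ι p0).2 (ι p2).2 hk0 hk2 (hgen p0 p2 (by omega) (by omega) (by omega))
      (fun h => hxi0 (Fin.ext (by rw [hxv, hxv]; exact h)))
    have x13m := modelLetter_ne_fst hN (ι p1).2 (ι p3).2 hk1 hk3 (hgen p1 p3 (by omega) (by omega) (by omega))
      (fun h => hxi1 (Fin.ext (by rw [hxv, hxv]; exact h)))
    have y12m := modelLetter_ne_snd hN (ι p1).2 (ι p2).2 hk1 hk2 (hgen p1 p2 (by omega) (by omega) (by omega))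
      (fun h => hχi0 (Fin.ext (by rw [hχv, hχv, hκ0, hκq p2 (by omega) (by omega)]; exact h)))
    have y03m := modelLetter_ne_snd hN (ι p0).2 (ι p3).2 hk0 hk3 (hgen p0 p3 (by omega) (by omega) (by omega))
      (fun h => hχi1 (Fin.ext (by rw [hχv, hχv, hκ1, hκq p3 (by omega) (by omega)]; exact h)))
    -- the value of `e_T` as the parity of the column reading, in model letters
    have hpar := oddHookTableau_apply_eq_parity hNY T hT h4 harm hlt hinj
    rw [hP0, hP1, hP2, hP3] at hpar
    rw [hwv p0, hwv p1, hwv p2, hwv p3, modelLetter_col hN (ι p0).2 hk0, modelLetter_col hN (ι p1).2 hk1,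
      modelLetter_col hN (ι p2).2 hk2, modelLetter_col hN (ι p3).2 hk3] at hpar
    have hsq := wordBlockSign_mul_self_of_ne_zero e hx0
    -- the four dichotomy cases
    rcases hd0 with ⟨h00, h22⟩ | ⟨h02, h20⟩ <;> rcases hd1 with ⟨h11, h33⟩ | ⟨h13, h31⟩
    · -- straight / straight: `χ = x`, column reading even
      have hχx : χ = x := by
        funext q
        by_cases hq : (q : ℕ) < 4
        · rcases hcases q hq with rfl | rfl | rfl | rfl
          · exact h00.symm
          · exact h11.symm
          · exact h22.symm
          · exact h33.symm
        · exact hagree q (by omega)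
      have a0m := modelLetter_eq hN (ι p0).2 (ι p1).2 hk0 hk1
        (by have h := congrArg Fin.val h00; rw [hxv, hχv, hκ0] at h; exact h)
      have a2m := modelLetter_eq hN (ι p2).2 (ι p2).2 hk2 hk2
        (by have h := congrArg Fin.val h22; rw [hxv, hχv, hκq p2 (by omega) (by omega)] at h; exact h)
      have b1m := modelLetter_eq hN (ι p1).2 (ι p0).2 hk1 hk0
        (by have h := congrArg Fin.val h11; rw [hxv, hχv, hκ1] at h; exact h)
      have b3m := modelLetter_eq hN (ι p3).2 (ι p3).2 hk3 hk3
        (by have h := congrArg Fin.val h33; rw [hxv, hχv, hκq p3 (by omega) (by omega)] at h; exact h)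
      have hparity := crossLift_model_SS k0 k1 k2 k3 hk0lt hk1lt hk2lt hk3lt hW01 hW02 hW03 hW12 hW13 hW23
        x02m x13m y12m y03m a0m a2m b1m b3m
      rw [hχx, hpar, if_pos hparity, mul_one]
      exact hsq
    · -- straight / crossed: `χ = x ∘ (p₁ p₃)`, column reading odd
      have hχx : χ = x ∘ ⇑(Equiv.swap p1 p3) := by
        funext q
        show χ q = x (Equiv.swap p1 p3 q)
        by_cases hq : (q : ℕ) < 4
        · rcases hcases q hq with rfl | rfl | rfl | rfl
          · rw [Equiv.swap_apply_of_ne_of_ne hp01 hp03]; exact h00.symm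
          · rw [Equiv.swap_apply_left]; exact h31.symm
          · rw [Equiv.swap_apply_of_ne_of_ne hp12.symm hp23]; exact h22.symm
          · rw [Equiv.swap_apply_right]; exact h13.symm
        · rw [Equiv.swap_apply_of_ne_of_ne (hpne (by omega)) (hpne (by omega))]; exact hagree q (by omega)
      have a0m := modelLetter_eq hN (ι p0).2 (ι p1).2 hk0 hk1
        (by have h := congrArg Fin.val h00; rw [hxv, hχv, hκ0] at h; exact h)
      have a2m := modelLetter_eq hN (ι p2).2 (ι p2).2 hk2 hk2
        (by have h := congrArg Fin.val h22; rw [hxv, hχv, hκq p2 (by omega) (by omega)] at h; exact h)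
      have b1m := modelLetter_eq hN (ι p1).2 (ι p3).2 hk1 hk3
        (by have h := congrArg Fin.val h13; rw [hxv, hχv, hκq p3 (by omega) (by omega)] at h; exact h)
      have b3m := modelLetter_eq hN (ι p3).2 (ι p0).2 hk3 hk0
        (by have h := congrArg Fin.val h31; rw [hxv, hχv, hκ1] at h; exact h)
      have hparity := crossLift_model_SC k0 k1 k2 k3 hk0lt hk1lt hk2lt hk3lt hW01 hW02 hW03 hW12 hW13 hW23
        x02m x13m y12m y03m a0m a2m b1m b3m
      rw [hχx, wordBlockSign_comp_swap ℂ e hp13 hblk13 x, hpar, if_neg (by omega)]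
      linear_combination hsq
    · -- crossed / straight: `χ = x ∘ (p₀ p₂)`, column reading odd
      have hχx : χ = x ∘ ⇑(Equiv.swap p0 p2) := by
        funext q
        show χ q = x (Equiv.swap p0 p2 q)
        by_cases hq : (q : ℕ) < 4
        · rcases hcases q hq with rfl | rfl | rfl | rfl
          · rw [Equiv.swap_apply_left]; exact h20.symm
          · rw [Equiv.swap_apply_of_ne_of_ne hp01.symm hp12]; exact h11.symm
          · rw [Equiv.swap_apply_right]; exact h02.symm
          · rw [Equiv.swap_apply_of_ne_of_ne hp03.symm hp23.symm]; exact h33.symm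
        · rw [Equiv.swap_apply_of_ne_of_ne (hpne (by omega)) (hpne (by omega))]; exact hagree q (by omega)
      have a0m := modelLetter_eq hN (ι p0).2 (ι p2).2 hk0 hk2
        (by have h := congrArg Fin.val h02; rw [hxv, hχv, hκq p2 (by omega) (by omega)] at h; exact h)
      have a2m := modelLetter_eq hN (ι p2).2 (ι p1).2 hk2 hk1
        (by have h := congrArg Fin.val h20; rw [hxv, hχv, hκ0] at h; exact h)
      have b1m := modelLetter_eq hN (ι p1).2 (ι p0).2 hk1 hk0
        (by have h := congrArg Fin.val h11; rw [hxv, hχv, hκ1] at h; exact h)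
      have b3m := modelLetter_eq hN (ι p3).2 (ι p3).2 hk3 hk3
        (by have h := congrArg Fin.val h33; rw [hxv, hχv, hκq p3 (by omega) (by omega)] at h; exact h)
      have hparity := crossLift_model_CS k0 k1 k2 k3 hk0lt hk1lt hk2lt hk3lt hW01 hW02 hW03 hW12 hW13 hW23
        x02m x13m y12m y03m a0m a2m b1m b3m
      rw [hχx, wordBlockSign_comp_swap ℂ e hp02 hblk02 x, hpar, if_neg (by omega)]
      linear_combination hsq
    · -- crossed / crossed: `χ = x ∘ (p₀ p₂)(p₁ p₃)`, column reading even
      have hχx : χ = (x ∘ ⇑(Equiv.swap p0 p2)) ∘ ⇑(Equiv.swap p1 p3) := by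
        funext q
        show χ q = x (Equiv.swap p0 p2 (Equiv.swap p1 p3 q))
        by_cases hq : (q : ℕ) < 4
        · rcases hcases q hq with rfl | rfl | rfl | rfl
          · rw [Equiv.swap_apply_of_ne_of_ne hp01 hp03, Equiv.swap_apply_left]; exact h20.symm
          · rw [Equiv.swap_apply_left, Equiv.swap_apply_of_ne_of_ne hp03.symm hp23.symm]; exact h31.symm
          · rw [Equiv.swap_apply_of_ne_of_ne hp12.symm hp23, Equiv.swap_apply_right]; exact h02.symm
          · rw [Equiv.swap_apply_right, Equiv.swap_apply_of_ne_of_ne hp01.symm hp12]; exact h13.symm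
        · rw [Equiv.swap_apply_of_ne_of_ne (a := p1) (b := p3) (x := q) (hpne (by omega)) (hpne (by omega)),
            Equiv.swap_apply_of_ne_of_ne (a := p0) (b := p2) (x := q) (hpne (by omega)) (hpne (by omega))]
          exact hagree q (by omega)
      have a0m := modelLetter_eq hN (ι p0).2 (ι p2).2 hk0 hk2
        (by have h := congrArg Fin.val h02; rw [hxv, hχv, hκq p2 (by omega) (by omega)] at h; exact h)
      have a2m := modelLetter_eq hN (ι p2).2 (ι p1).2 hk2 hk1
        (by have h := congrArg Fin.val h20; rw [hxv, hχv, hκ0] at h; exact h)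
      have b1m := modelLetter_eq hN (ι p1).2 (ι p3).2 hk1 hk3
        (by have h := congrArg Fin.val h13; rw [hxv, hχv, hκq p3 (by omega) (by omega)] at h; exact h)
      have b3m := modelLetter_eq hN (ι p3).2 (ι p0).2 hk3 hk0
        (by have h := congrArg Fin.val h31; rw [hxv, hχv, hκ1] at h; exact h)
      have hparity := crossLift_model_CC k0 k1 k2 k3 hk0lt hk1lt hk2lt hk3lt hW01 hW02 hW03 hW12 hW13 hW23
        x02m x13m y12m y03m a0m a2m b1m b3m
      rw [hχx, wordBlockSign_comp_swap ℂ e hp13 hblk13 (x ∘ ⇑(Equiv.swap p0 p2)),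
        wordBlockSign_comp_swap ℂ e hp02 hblk02 x, hpar, if_pos hparity]
      linear_combination hsq
  -- the summands are `0` or `1`
  have hterm : ∀ ι : Fin (N * 2) → Fin (N + 2),
      wordBlockSign ℂ e (φ ∘ ι) * (wordBlockSign ℂ e' (ψ ∘ ι) * StdFilling.polytabloid ℂ hNY T (γ ∘ ι)) =
        if wordBlockSign ℂ e (φ ∘ ι) * (wordBlockSign ℂ e' (ψ ∘ ι) * StdFilling.polytabloid ℂ hNY T (γ ∘ ι)) ≠ 0
        then 1 else 0 := by
    intro ι
    by_cases h : wordBlockSign ℂ e (φ ∘ ι) * (wordBlockSign ℂ e' (ψ ∘ ι) * StdFilling.polytabloid ℂ hNY T (γ ∘ ι)) = 0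
    · rw [h, if_neg (not_not.2 rfl)]
    · rw [if_pos h, hVAL ι h]
  intro hsum
  rw [Finset.sum_congr rfl (fun ι _ => hterm ι), Finset.sum_boole, Nat.cast_eq_zero,
    Finset.card_eq_zero, Finset.filter_eq_empty_iff] at hsum
  -- the witness `ι_w = (N, N+1, 1, 0 | j ↦ j)`
  obtain ⟨ιw, hιw⟩ : ∃ ι : Fin (N * 2) → Fin (N + 2), ∀ q, ((ι q : Fin (N + 2)) : ℕ) =
      if (q : ℕ) = 0 then N else if (q : ℕ) = 1 then N + 1 else if (q : ℕ) = 2 then 1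
        else if (q : ℕ) = 3 then 0 else (q : ℕ) / 2 :=
    ⟨fun q => ⟨if (q : ℕ) = 0 then N else if (q : ℕ) = 1 then N + 1 else if (q : ℕ) = 2 then 1
        else if (q : ℕ) = 3 then 0 else (q : ℕ) / 2, by have := q.2; split_ifs <;> omega⟩, fun q => rfl⟩
  apply hsum (Finset.mem_univ ιw)
  rw [hζ']
  -- the first two legs agree: `ψ ∘ ι_w ∘ κ = φ ∘ ι_w`
  have hxwv : ∀ q : Fin (N * 2), (((φ ∘ ιw) q : Fin N) : ℕ) =
      if (q : ℕ) = 0 then 0 else if (q : ℕ) = 1 then 1 else if (q : ℕ) = 2 then 1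
        else if (q : ℕ) = 3 then 0 else (q : ℕ) / 2 := by
    intro q
    show ((φ (ιw q) : Fin N) : ℕ) = _
    rw [hφv, hιw]
    have := q.2
    split_ifs <;> omega
  have hιw0 : ((ιw p0 : Fin (N + 2)) : ℕ) = N := by rw [hιw, hp0]; simp
  have hιw1 : ((ιw p1 : Fin (N + 2)) : ℕ) = N + 1 := by rw [hιw, hp1]; simp
  have hχw : (ψ ∘ ιw) ∘ ⇑κ = φ ∘ ιw := by
    funext q
    apply Fin.ext
    show ((ψ (ιw (κ q)) : Fin N) : ℕ) = (((φ ∘ ιw) q : Fin N) : ℕ)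
    rw [hxwv, hψv]
    by_cases hq : (q : ℕ) < 2
    · rcases hcases q (by omega) with rfl | rfl | rfl | rfl
      · rw [hκ0, hιw1, hp0, if_neg (by omega)]; simp
      · rw [hκ1, hιw0, hp1, if_neg (by omega)]; simp
      · omega
      · omega
    · rw [hκq q (by omega) (by omega), hιw]
      have := q.2
      split_ifs <;> omega
  -- `φ ∘ ι_w` is a block bijection (block `0`: the identity; block `1`: the transposition `(0 1)`)
  have hblkw : ∀ (a : Fin 2) (j : Fin N), (((φ ∘ ιw) (e.symm (a, j)) : Fin N) : ℕ) =
      if (a : ℕ) = 1 ∧ (j : ℕ) = 0 then 1 else if (a : ℕ) = 1 ∧ (j : ℕ) = 1 then 0 else (j : ℕ) := by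
    intro a j
    rw [hxwv, hesymm]
    have := a.2
    split_ifs <;> omega
  have hbijw : ∀ a : Fin 2, Function.Bijective (fun j => (φ ∘ ιw) (e.symm (a, j))) := by
    intro a
    refine (Finite.injective_iff_bijective).1 fun j j' h => Fin.ext ?_
    have h' : (((φ ∘ ιw) (e.symm (a, j)) : Fin N) : ℕ) = (((φ ∘ ιw) (e.symm (a, j')) : Fin N) : ℕ) :=
      congrArg Fin.val h
    rw [hblkw, hblkw] at h'
    split_ifs at h' <;> omega
  have hxw0 : wordBlockSign ℂ e (φ ∘ ιw) ≠ 0 := by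
    unfold wordBlockSign
    rw [if_pos hbijw]
    exact Finset.prod_ne_zero_iff.2 fun a _ => Int.cast_ne_zero.2 (Units.ne_zero _)
  -- the third leg is a column word of `T`
  have hwwv : ∀ q : Fin (N * 2), (((γ ∘ ιw) q : Fin N) : ℕ) =
      if (q : ℕ) = 0 then 1 else if (q : ℕ) = 1 then 3 else if (q : ℕ) = 2 then 2 else 0 := by
    intro q
    show ((γ (ιw q) : Fin N) : ℕ) = _
    rw [hγv, hιw]
    have := q.2
    split_ifs <;> omega
  have harmw : ∀ q : Fin (N * 2), 4 ≤ (q : ℕ) → (((γ ∘ ιw) q : Fin N) : ℕ) = 0 := by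
    intro q hq; rw [hwwv]; split_ifs <;> omega
  have hltw : ∀ q : Fin (N * 2), (q : ℕ) < 4 → (((γ ∘ ιw) q : Fin N) : ℕ) < 4 := by
    intro q hq; rw [hwwv]; split_ifs <;> omega
  have hinjw : ∀ q q' : Fin (N * 2), (q : ℕ) < 4 → (q' : ℕ) < 4 → (γ ∘ ιw) q = (γ ∘ ιw) q' → q = q' := by
    intro q q' hq hq' h
    have h' := congrArg Fin.val h
    rw [hwwv, hwwv] at h'
    apply Fin.ext
    split_ifs at h' <;> omega
  rw [hχw, ← mul_assoc, wordBlockSign_mul_self_of_ne_zero e hxw0, one_mul,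
    oddHookTableau_apply_eq_parity hNY T hT h4 harmw hltw hinjw]
  split_ifs <;> norm_num

end Summit.MatrixMultiplication.MatrixMultiplication.Theorems.ObstructionCalculus

end
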